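import Mathlib.RingTheory.Finiteness.Nakayama
import Mathlib.RingTheory.Localization.Ideal
import Mathlib.RingTheory.Localization.Submodule
import Literature.AlgebraicGeometry.Resolution.StrictlyStandardPowers
import HarnessLib

/-!
# Stacks 07CP (the lifting lemma), general case — I. The relations (4)

Topic: `Literature/AlgebraicGeometry/Resolution`. The Stacks Project, *Smoothing Ring Maps*
(Tag 07BW), Lemma 07CP, first part of the printed proof, for ONE chart: given generators
`G` of `C̄` over `R' = R/π²R`, an element `a ∈ C̄` with `C̄_a` smooth and elements
`b_1, …, b_c ∈ I = ker(R'[x] → C̄)` whose classes form a basis of `(I/I²)_a`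
(such charts cover the smooth locus: `NeronPopescuLiftingCharts.lean`), we prove
> (3) `(Ī_k)_{a_k} = (Ī)_{a_k}` … Thus, after possibly replacing `a_k` by a high power, we may
> write (4) `a_k f_ℓ = ∑_{j ∈ E_k} h^j_{k,ℓ} f_j + π² g_{k,ℓ}` for any `ℓ` and some
> `h^j_{k,ℓ}, g_{k,ℓ} ∈ R[x_1, …, x_n]`.
in the following form: `exists_pow_mul_ker_le` (a power of `σ(a)` multiplies `I` into
`(b) + I²`, from `Stacks07EZ.exists_pow_mul_mem_span_sup`), `exists_mul_ker_le_span` (Nakayama: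
some `s ≡ σ(a)^e mod I` multiplies `I` into `(b)`; this is (3)), `exists_lift_relations` (lift to
`R[x]`: relations (4) with `ã ↦ a^e`), and the coefficient comparison in the free module
`(I/I²)_a` used later in the proof (`exists_pow_mul_eq_zero_of_sum_eq_zero`: "Since
`(Ī_k/Ī_k²)_{a_k}` is free on `f_j`, `j ∈ E_k` we see that … is zero in `C̄_{a_k}`").
All statements are proved; no new notions, no named facts.

## References

* The Stacks Project, *Smoothing Ring Maps* (Tag 07BW), Lemma 07CP and its proof. [StacksProject]
-/

noncomputable section

open MvPolynomial TensorProduct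

namespace Literature.AlgebraicGeometry.Resolution

namespace Stacks07CP

universe u

variable {R' C : Type u} [CommRing R'] [CommRing C] [Algebra R' C] [IsNoetherianRing R']
  [Algebra.FinitePresentation R' C] {n : ℕ} (G : Algebra.Generators R' C (Fin n)) (a : C)
  {c : ℕ} (x : Fin c → G.toExtension.ker)
  (B : Module.Basis (Fin c) (Localization.Away a) (Stacks07EZ.LocCot G a))
  (hB : ∀ k, B k = (1 : Localization.Away a) ⊗ₜ[C] Algebra.Extension.Cotangent.mk (x k))

omit [IsNoetherianRing R'] in
set_option backward.isDefEq.respectTransparency false in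
include hB in
/-- Step (1): a single power of `α = σ(a)` multiplies `J` into `J_b + J²`.
[cite: StacksProject, Tag 07CP] -/
theorem exists_pow_mul_ker_le :
    ∃ E : ℕ, ∀ f ∈ G.toExtension.ker, G.toExtension.σ a ^ E * f ∈
      Ideal.span (Set.range fun k => (x k).val) ⊔ G.toExtension.ker ^ 2 := by
  classical
  obtain ⟨t, g, hg⟩ :=
    Submodule.fg_iff_exists_fin_generating_family.mp G.fg_ker_of_finitePresentation
  have hgmem : ∀ j, (g j : G.toExtension.Ring) ∈ G.toExtension.ker := fun j => by
    have : g j ∈ Submodule.span G.Ring (Set.range g) := Submodule.subset_span ⟨j, rfl⟩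
    rw [hg] at this
    exact this
  choose E hE using fun j => Stacks07EZ.exists_pow_mul_mem_span_sup G a x B hB (g j) (hgmem j)
  refine ⟨∑ j, E j, fun f hf => ?_⟩
  have hf' : f ∈ Submodule.span G.Ring (Set.range g) := by rw [hg]; exact hf
  clear hf
  induction hf' using Submodule.span_induction with
  | mem f hfg =>
    obtain ⟨j, rfl⟩ := hfg
    exact hE j _ (Finset.single_le_sum (fun _ _ => Nat.zero_le _) (Finset.mem_univ j))
  | zero => simp
  | add p q _ _ hp hq => rw [mul_add]; exact Ideal.add_mem _ hp hq
  | smul r p _ hp =>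
    rw [smul_eq_mul, mul_left_comm]
    exact Ideal.mul_mem_left _ _ hp


omit [IsNoetherianRing R'] [Algebra.FinitePresentation R' C] in
/-- Clearing denominators in `S_α`: if `y/1 ∈ K S_α` then `α^N y ∈ K`. [folklore] -/
theorem exists_pow_mul_mem_of_map {K : Ideal G.toExtension.Ring} (α y : G.toExtension.Ring)
    (h : algebraMap _ (Localization.Away α) y ∈ K.map (algebraMap _ (Localization.Away α))) :
    ∃ N : ℕ, α ^ N * y ∈ K := by
  obtain ⟨⟨⟨j, hj⟩, ⟨_, p, rfl⟩⟩, h'⟩ :=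
    (IsLocalization.mem_map_algebraMap_iff (Submonoid.powers α) (Localization.Away α)).mp h
  simp only at h'
  rw [← map_mul] at h'
  obtain ⟨⟨_, q, rfl⟩, hc⟩ := (IsLocalization.eq_iff_exists (Submonoid.powers α) (Localization.Away α)).mp h'
  simp only at hc
  refine ⟨q + p, ?_⟩
  rw [show α ^ (q + p) * y = α ^ q * (y * α ^ p) by ring, hc]
  exact Ideal.mul_mem_left _ _ hj

include hB in
set_option maxHeartbeats 800000 in
/-- **P3 over `R'`** (Stacks 07CP: "By (2) and Nakayama's lemma we see that `(Ī/Ī_k)_{a_k}` is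
annihilated by `1 + b'_k` … After replacing `a_k` by `a_kb_k` we get (3) `(Ī_k)_{a_k} = Ī_{a_k}`.
Thus, after possibly replacing `a_k` by a high power, …"): there is `s ≡ σ(a)^e mod J` with
`sJ ⊆ J_b = (b_1, …, b_c)`. [cite: StacksProject, Tag 07CP] -/
theorem exists_mul_ker_le_span :
    ∃ (s : G.toExtension.Ring) (e : ℕ), s - G.toExtension.σ a ^ e ∈ G.toExtension.ker ∧
      ∀ f ∈ G.toExtension.ker, s * f ∈ Ideal.span (Set.range fun k => (x k).val) := by
  classical
  obtain ⟨E, hE⟩ := exists_pow_mul_ker_le G a x B hB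
  let α : G.toExtension.Ring := G.toExtension.σ a
  let S := Localization.Away α
  let J : Ideal G.toExtension.Ring := G.toExtension.ker
  let Jb : Ideal G.toExtension.Ring := Ideal.span (Set.range fun k => (x k).val)
  let Jα : Ideal S := J.map (algebraMap _ S)
  let Jbα : Ideal S := Jb.map (algebraMap _ S)
  have hαu : IsUnit (algebraMap _ S α) := IsLocalization.Away.algebraMap_isUnit α
  -- `Jα ≤ Jbα ⊔ Jα²`
  have hle : Jα ≤ Jbα ⊔ Jα ^ 2 := by
    rw [Ideal.map_le_iff_le_comap]
    intro f hf
    have h1 : algebraMap _ S (α ^ E * f) ∈ Jbα ⊔ Jα ^ 2 := by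
      have := Ideal.mem_map_of_mem (algebraMap _ S) (hE f hf)
      rwa [Ideal.map_sup, Ideal.map_pow] at this
    rw [map_mul, map_pow] at h1
    have h2 := Ideal.mul_mem_left _ (↑((hαu.pow E).unit⁻¹) : S) h1
    rwa [← mul_assoc, IsUnit.val_inv_mul, one_mul] at h2
  -- Nakayama for `N = image of Jα in S/Jbα`
  let N : Submodule S (S ⧸ Jbα) := Submodule.map Jbα.mkQ Jα
  haveI : IsNoetherianRing G.toExtension.Ring :=
    inferInstanceAs (IsNoetherianRing (MvPolynomial (Fin n) R'))
  haveI : IsNoetherianRing S :=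
    IsLocalization.isNoetherianRing (Submonoid.powers α) S inferInstance
  haveI : IsNoetherian S (S ⧸ Jbα) := isNoetherian_of_isNoetherianRing_of_finite S _
  have hNfg : N.FG := IsNoetherian.noetherian N
  have hN : N ≤ Jα • N := by
    rintro _ ⟨z, hz, rfl⟩
    obtain ⟨u, hu, v, hv, huv⟩ := Submodule.mem_sup.mp (hle hz)
    have hu0 : Jbα.mkQ u = 0 := (Submodule.Quotient.mk_eq_zero Jbα).mpr hu
    have : Jbα.mkQ z = Jbα.mkQ v := by rw [← huv, map_add, hu0, zero_add]
    rw [this]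
    rw [pow_two] at hv
    refine Submodule.mul_induction_on hv (fun p hp q hq => ?_) (fun _ _ h1 h2 => ?_)
    · change Jbα.mkQ (p • q) ∈ _
      rw [map_smul]
      exact Submodule.smul_mem_smul hp (Submodule.mem_map_of_mem hq)
    · rw [map_add]; exact Submodule.add_mem _ h1 h2
  obtain ⟨r, hr1, hrN⟩ := Submodule.exists_sub_one_mem_and_smul_eq_zero_of_fg_of_le_smul Jα N hNfg hN
  -- `r • Jα ≤ Jbα`
  have hrJ : ∀ z ∈ Jα, r * z ∈ Jbα := fun z hz => by
    have := hrN _ (Submodule.mem_map_of_mem (f := Jbα.mkQ) hz)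
    rw [← map_smul, smul_eq_mul] at this
    exact (Submodule.Quotient.mk_eq_zero Jbα).mp this
  -- write `r = s₀ / α^m`
  obtain ⟨⟨s₀, ⟨_, m, rfl⟩⟩, hs₀⟩ := IsLocalization.surj (Submonoid.powers α) r
  simp only at hs₀
  -- `s₀ ≡ α^m` modulo `J` up to a power of `α`
  have h1 : algebraMap _ S (s₀ - α ^ m) ∈ Jα := by
    rw [map_sub, ← hs₀, map_pow, show r * algebraMap _ S α ^ m - algebraMap _ S α ^ m =
      (r - 1) * algebraMap _ S α ^ m by ring]
    exact Ideal.mul_mem_right _ _ hr1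
  obtain ⟨N₁, hN₁⟩ := exists_pow_mul_mem_of_map G α _ h1
  -- `s₀ J ⊆ J_b` up to a power of `α`
  have hfg : (G.toExtension.ker : Ideal G.toExtension.Ring).FG := G.fg_ker_of_finitePresentation
  obtain ⟨t, g, hg⟩ := Submodule.fg_iff_exists_fin_generating_family.mp hfg
  have hgmem : ∀ j, g j ∈ J := fun j => by
    have : g j ∈ Submodule.span G.toExtension.Ring (Set.range g) := Submodule.subset_span ⟨j, rfl⟩
    rw [hg] at this
    exact this
  have h2 : ∀ j, ∃ N : ℕ, α ^ N * (s₀ * g j) ∈ Jb := fun j => by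
    refine exists_pow_mul_mem_of_map G α _ ?_
    rw [map_mul, ← hs₀, mul_assoc, mul_comm (algebraMap _ S (α ^ m)), ← mul_assoc]
    exact Ideal.mul_mem_right _ _ (hrJ _ (Ideal.mem_map_of_mem _ (hgmem j)))
  choose N₂ hN₂ using h2
  let N := ∑ j, N₂ j
  have h3 : ∀ f ∈ J, α ^ N * (s₀ * f) ∈ Jb := by
    intro f hf
    have hf' : f ∈ Submodule.span G.toExtension.Ring (Set.range g) := by rw [hg]; exact hf
    clear hf
    induction hf' using Submodule.span_induction with
    | mem f hfg =>
      obtain ⟨j, rfl⟩ := hfg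
      have hle : N₂ j ≤ N := Finset.single_le_sum (fun _ _ => Nat.zero_le _) (Finset.mem_univ j)
      rw [← Nat.sub_add_cancel hle, pow_add, mul_assoc]
      exact Ideal.mul_mem_left _ _ (hN₂ j)
    | zero => rw [mul_zero, mul_zero]; exact Submodule.zero_mem _
    | add p q _ _ hp hq => rw [mul_add, mul_add]; exact Ideal.add_mem _ hp hq
    | smul c p _ hp =>
      rw [smul_eq_mul, show α ^ N * (s₀ * (c * p)) = c * (α ^ N * (s₀ * p)) by ring]
      exact Ideal.mul_mem_left _ _ hp
  refine ⟨α ^ (N₁ + N) * s₀, m + N₁ + N, ?_, fun f hf => ?_⟩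
  · rw [show α ^ (N₁ + N) * s₀ - α ^ (m + N₁ + N) = α ^ N * (α ^ N₁ * (s₀ - α ^ m)) by ring]
    exact Ideal.mul_mem_left _ _ hN₁
  · rw [show α ^ (N₁ + N) * s₀ * f = α ^ N₁ * (α ^ N * (s₀ * f)) by ring]
    exact Ideal.mul_mem_left _ _ (h3 f hf)

/-! ### Lifting the relations to `R` -/

omit [IsNoetherianRing R'] [Algebra.FinitePresentation R' C] in
include hB in
set_option maxHeartbeats 800000 in
/-- **Relations (4) of Stacks 07CP**, lifted to `R[x]`: with `R' = R/π²R`, `red : R[x] → R'[x]`,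
there are `ã ∈ R[x]` mapping to `a^e` in `C̄`, lifts `b̃_k ∈ I` of the basis elements, and for every
`f ∈ I` polynomials `h_k, g` with `ã f = ∑_k h_k b̃_k + π² g` ("(4) `a_k f_ℓ = ∑_{j ∈ E_k}
h^j_{k,ℓ} f_j + π² g_{k,ℓ}`"). [cite: StacksProject, Tag 07CP] -/
theorem exists_lift_relations {R : Type u} [CommRing R] [IsNoetherianRing R] (π : R)
    [Algebra R C] [Algebra.FinitePresentation R C] [Algebra R R'] [IsScalarTower R R' C]
    (hR' : Function.Surjective (algebraMap R R'))
    (hker : RingHom.ker (algebraMap R R') = Ideal.span {π ^ 2})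
    [IsNoetherianRing R'] [Algebra.FinitePresentation R' C]
    (G₀ : Algebra.Generators R C (Fin n)) (hval : ∀ i, G.val i = G₀.val i) :
    ∃ (ã : MvPolynomial (Fin n) R) (e : ℕ) (bt : Fin c → MvPolynomial (Fin n) R),
      aeval G₀.val ã = a ^ e ∧ (∀ k, aeval G₀.val (bt k) = 0) ∧
      (∀ k, MvPolynomial.map (algebraMap R R') (bt k) = (x k).val) ∧
      ∀ f : MvPolynomial (Fin n) R, aeval G₀.val f = 0 →
        ∃ (h : Fin c → MvPolynomial (Fin n) R) (g : MvPolynomial (Fin n) R),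
          ã * f = ∑ k, h k * bt k + MvPolynomial.C (π ^ 2) * g := by
  classical
  obtain ⟨s, e, hs, hsJ⟩ := exists_mul_ker_le_span G a x B hB
  let red : MvPolynomial (Fin n) R →+* MvPolynomial (Fin n) R' := MvPolynomial.map (algebraMap R R')
  have hred : Function.Surjective red := MvPolynomial.map_surjective _ hR'
  have haeval : ∀ p : MvPolynomial (Fin n) R,
      algebraMap G.toExtension.Ring C (red p) = aeval G₀.val p := fun p => by
    change algebraMap G.Ring C (MvPolynomial.map (algebraMap R R') p) = _
    rw [Algebra.Generators.algebraMap_apply, show G.val = G₀.val from funext hval]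
    exact MvPolynomial.aeval_map_algebraMap R' G₀.val p
  have hkerred : RingHom.ker red =
      Ideal.span {(MvPolynomial.C (π ^ 2) : MvPolynomial (Fin n) R)} := by
    change RingHom.ker (MvPolynomial.map _) = _
    rw [MvPolynomial.ker_map, hker, Ideal.map_span, Set.image_singleton]
  have hmemker : ∀ p : G.toExtension.Ring,
      p ∈ G.toExtension.ker ↔ algebraMap G.toExtension.Ring C p = 0 := fun p => Iff.rfl
  obtain ⟨ã, hã⟩ := hred s
  choose bt hbt using fun k => hred (x k).val
  refine ⟨ã, e, bt, ?_, fun k => ?_, hbt, fun f hf => ?_⟩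
  · have hse : algebraMap G.toExtension.Ring C s = a ^ e := by
      have h0 := (hmemker _).mp hs
      rw [map_sub, map_pow, sub_eq_zero, G.toExtension.algebraMap_σ] at h0
      exact h0
    rw [← haeval, hã, hse]
  · rw [← haeval, hbt]
    exact (hmemker _).mp (x k).2
  · have hredf : red f ∈ G.toExtension.ker := (hmemker _).mpr (by rw [haeval, hf])
    have h1 : red (ã * f) ∈ Ideal.span (Set.range fun k => (x k).val) := by
      rw [map_mul, hã]; exact hsJ _ hredf
    have h2 : ã * f ∈ Ideal.span (Set.range bt) ⊔ RingHom.ker red := by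
      have hfun : (fun k : Fin c => ((x k).val : G.toExtension.Ring)) = fun k => red (bt k) :=
        funext fun k => (hbt k).symm
      have : Ideal.span (Set.range fun k => (x k).val) = (Ideal.span (Set.range bt)).map red := by
        rw [Ideal.map_span, ← Set.range_comp, hfun]
        rfl
      rw [this] at h1
      have h1' := Ideal.mem_comap.mpr h1
      rw [Ideal.comap_map_of_surjective red hred, ← RingHom.ker_eq_comap_bot] at h1'
      exact h1'
    rw [hkerred] at h2
    obtain ⟨u, hu, v, hv, huv⟩ := Submodule.mem_sup.mp h2
    obtain ⟨h, hh⟩ := (Ideal.mem_span_range_iff_exists_fun).mp hu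
    obtain ⟨g, hg⟩ := Ideal.mem_span_singleton'.mp hv
    exact ⟨h, g, by rw [← huv, ← hh, ← hg, mul_comm g]⟩

omit [IsNoetherianRing R'] [Algebra.FinitePresentation R' C] in
/-- `R[x] → R'[x] → C̄` is evaluation at the generators. [folklore] -/
theorem algebraMap_map_eq_aeval {R : Type u} [CommRing R] [Algebra R C] [Algebra R R']
    [IsScalarTower R R' C] (G₀ : Algebra.Generators R C (Fin n)) (hval : ∀ i, G.val i = G₀.val i)
    (p : MvPolynomial (Fin n) R) :
    algebraMap G.toExtension.Ring C (MvPolynomial.map (algebraMap R R') p) = aeval G₀.val p := by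
  change algebraMap G.Ring C (MvPolynomial.map (algebraMap R R') p) = _
  rw [Algebra.Generators.algebraMap_apply, show G.val = G₀.val from funext hval]
  exact MvPolynomial.aeval_map_algebraMap R' G₀.val p

omit [IsNoetherianRing R'] [Algebra.FinitePresentation R' C] in
include hB in
set_option backward.isDefEq.respectTransparency false in
/-- **Coefficient comparison in the free module `(I/I²)_a`** (Stacks 07CP: "Since
`(Ī_k/Ī_k²)_{a_k}` is free on `f_j`, `j ∈ E_k` we see that … is zero in `C̄_{a_k}`"): if
`∑_j c_j b_j = 0` in `R'[x]` then each `c_j` is killed by a power of `a` in `C̄`.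
[cite: StacksProject, Tag 07CP] -/
theorem exists_pow_mul_eq_zero_of_sum_eq_zero (coef : Fin c → G.toExtension.Ring)
    (hsum : ∑ j, coef j * (x j).val = 0) (j : Fin c) :
    ∃ N : ℕ, a ^ N * algebraMap G.toExtension.Ring C (coef j) = 0 := by
  classical
  -- the element `∑ c_j • x_j` of `J` is zero
  have hw : (∑ j, coef j • x j : G.toExtension.ker) = 0 := by
    apply Subtype.ext
    simp only [AddSubmonoidClass.coe_finsetSum, Submodule.coe_smul, smul_eq_mul,
      ZeroMemClass.coe_zero]
    exact hsum
  -- hence `∑ c̄_j • x̄_j = 0` in `I/I²`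
  have hcot : ∑ j, algebraMap G.toExtension.Ring C (coef j) •
      Algebra.Extension.Cotangent.mk (x j) = 0 := by
    have := congrArg Algebra.Extension.Cotangent.mk hw
    rw [map_sum, map_zero] at this
    rw [← this]
    refine Finset.sum_congr rfl fun j _ => ?_
    rw [LinearMap.map_smul, algebraMap_smul]
  -- apply `1 ⊗ -` and compare coefficients in the basis
  have hloc : ∑ j, algebraMap C (Localization.Away a) (algebraMap G.toExtension.Ring C (coef j)) •
      B j = 0 := by
    have := congrArg (TensorProduct.mk C (Localization.Away a) G.toExtension.Cotangent 1) hcot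
    rw [map_sum, map_zero] at this
    rw [← this]
    refine Finset.sum_congr rfl fun j _ => ?_
    rw [LinearMap.map_smul, algebraMap_smul, TensorProduct.mk_apply, hB j]
  have hj := Fintype.linearIndependent_iff.mp B.linearIndependent _ hloc j
  obtain ⟨⟨_, N, rfl⟩, hN⟩ := (IsLocalization.map_eq_zero_iff (Submonoid.powers a)
    (Localization.Away a) _).mp hj
  exact ⟨N, hN⟩

end Stacks07CP

end Literature.AlgebraicGeometry.Resolution

end
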